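import Summits.HodgeConjecture.HodgeConjecture.Theorems.Q8CommutatorDegreeTwoCore

/-!
# Route `Q8SymplecticPowers`, crux K2Q — stub `stub_q8CommutatorDegreeTwoCore` DISCHARGED

The registered birth skeleton `Cruxes/PowersHodgeOfQuaternionCommutators/Lines/birth.lean` of crux
`PowersHodgeOfQuaternionCommutators` (item stmt-HodgeConjecture-24191) has three stubs; the first,
`stub_q8CommutatorDegreeTwoCore` (the degree-2 engine: a bilinear form on the `(-1)`-eigenspace of `τ*²`
invariant under every commutator of the quaternionic centraliser is `x y ↦ Q x (d y)` with
`d ∈ span {1, a, b, ab}`), is exactly the universe-0 specialisation of the landed rung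
`Theorems.Q8CommutatorDegreeTwoCore.rung_q8CommutatorDegreeTwoCore` (p704706 + p705032).  This file
proves the stub BY NAME AND SIGNATURE so the skeleton check credits it; the remaining stubs are
`stub_squareQ` (k ≤ 1 from the engine + comparison isomorphisms) and `stub_higherPowersQ` (FFT for Sp
over the quaternion algebra, all k).  hodge-nonav planner P3 g35, 2026-08-29.  No sorries, no new axioms.
-/

namespace Summit.HodgeConjecture.HodgeConjecture.Theorems.Q8SymplecticPowersStubDegreeTwoCore

/-- Registered stub `stub_q8CommutatorDegreeTwoCore` of the K2Q birth skeleton, discharged by the rung. -/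
theorem stub_q8CommutatorDegreeTwoCore :
    ∀ (K V : Type) [Field K] [CharZero K] [AddCommGroup V] [Module K V] (Q : LinearMap.BilinForm K V), (∀ x y, Q x y = Q y x) → Q.Nondegenerate → ∀ (a b : V →ₗ[K] V), (∀ x, a (a x) = -x) → (∀ x, b (b x) = -x) → (∀ x, a (b x) = -b (a x)) → (∀ x y, Q (a x) (a y) = Q x y) → (∀ x y, Q (b x) (b y) = Q x y) → ∀ (i : K), i * i = -1 → ∀ (c : LinearMap.BilinForm K V), (∀ g h : V ≃ₗ[K] V, (∀ x, g (a x) = a (g x)) → (∀ x, g (b x) = b (g x)) → (∀ x y, Q (g x) (g y) = Q x y) → (∀ x, h (a x) = a (h x)) → (∀ x, h (b x) = b (h x)) → (∀ x y, Q (h x) (h y) = Q x y) → ∀ x y, c ((g * h * g⁻¹ * h⁻¹) x) ((g * h * g⁻¹ * h⁻¹) y) = c x y) → ∃ α β γ δ : K, ∀ x y, c x y = α * Q x y + β * Q x (a y) + γ * Q x (b y) + δ * Q x (a (b y)) :=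
  fun K V _ _ _ _ Q hQs hQn a b haa hbb hab haQ hQb i hi c hc =>
    Summit.HodgeConjecture.HodgeConjecture.Theorems.Q8CommutatorDegreeTwoCore.rung_q8CommutatorDegreeTwoCore
      K V Q hQs hQn a b haa hbb hab haQ hQb i hi c hc

end Summit.HodgeConjecture.HodgeConjecture.Theorems.Q8SymplecticPowersStubDegreeTwoCore
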